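import Summits.BirchSwinnertonDyer.Rank1Residual.Additive.QuadraticBranchPlusKatoDivisibility
import Summits.BirchSwinnertonDyer.Rank1Residual.Additive.CyclotomicTowerSignedSelmerDual
import Literature.NumberTheory.EllipticCurves.Kobayashi2003.PlusEtaCharIdealDivisibility
import HarnessLib

/-!
# Kobayashi's EVEN main conjecture AT `η = ω^{(p−1)/2}` and its EISENSTEIN half, stated VERBATIM on
# the `η`-component object `X⁺(V/K_∞)^η` (print currency, no descent reading) — two typed nodes and
# their bookkeeping against Thm. 2.2 / Thm. 4.1 at `η` (cell `bsd-potss`, seat `bsd-potss-k8q-c2` g2;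
# K8 route `QuadraticBranchSignedControl`, items stmt-BirchSwinnertonDyer-19242 / 19114 / 19243)

HONEST FRAMING (cell `bsd-potss`, run/shared/lean/pub/bsd-potss/; FULL-BSD rank ≤ 1 programme,
tranche 1b, HUMAN RULING D-0036/D-0074; verbatim in every file): the target of record is FULL BSD for
every analytic-rank ≤ 1 curve over `ℚ`; this cell attacks rows B4/B5/B8 (additive potentially
supersingular primes). THIS FILE types TWO statements as `@[conjecture] def`s — Kobayashi's even main
conjecture at the quadratic character `η` EXACTLY AS PRINTED (Invent. Math. 152 (2003) §4 p. 8: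
"**Conjecture (Even main conjecture).** For every `η`, we have `Char(X⁺(E/K_∞)^η) = (L_p⁺(E, η, X))`")
on the tree's transcription of Kobayashi's OWN object `X⁺(E/K_∞)^η` (`EtaSignedSelmerDualData`,
`CyclotomicTowerSignedSelmer.lean`), and its lower ("Eisenstein") inclusion `⊆` — and proves the
bookkeeping between them and the NAMED Literature facts Thm. 2.2 at `η`
(`Kobayashi2003.thm22_etaSignedSelmerDual_finite_torsion`) and Thm. 4.1 first display at `η`
(`Kobayashi2003.thm41_plusEtaCharIdeal_dvd`). TYPED INPUTS, nothing asserted; no named Literature fact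
minted; no `sorry`, axioms standard; the even main conjecture at `η ≠ 1` is a CONJECTURE IN PRINT, a
theorem for NO curve (CM: Pollack–Rubin 2004 p. 448 is a remark; non-CM: the proved ±/Kato main
conjectures sit on the trivial component of `Δ`); the class served (Gss2 = O5 ∩ `e = 2`, `p ≥ 5`:
216 r0 + 157 r1 isogeny classes) stays OPEN; nothing is booked; no label / mark / count of
`RESIDUAL-MAP.md` moves. This is not "finishing BSD".

## Why these two nodes (planner bsd-potss-plan g10, TARGET R90, option (a) "η-level VERBATIM currency",
## deferred at K8 rev 6 until "the η-level nodes + descent frame land")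

The K8 even-main-conjecture block is typed in the cell's `ℚ(√p*)`-SUBTOWER currency: (C1_η)
`QuadraticBranchPlusMainConjectureAt V p` (`Char X⁺(V/F_∞) = Char X⁺(V/ℚ_∞)·(L_p⁺(V,η,X))`,
`F = ℚ(√p*)`), re-cut at its print seam into the Kato half (RK⁺) `QuadraticBranchPlusKatoDivisibilityAt`
(item 19241) and the Eisenstein half (E⁺) `QuadraticBranchPlusLowerInclusionAt` (item 19242, crux).
Both carry the READING FLAG `Kob03-MC-eta-quadratic-subtower` (the prime-to-`p` descent
`X⁺(V/F_∞) ≅ X⁺(V/ℚ_∞) ⊕ X⁺(V/K_∞)^η`, the cell's WANTED piece (i), seats ctrl / k8q-c3). The PRINTED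
statement is about the `η`-component `X⁺(V/K_∞)^η` itself, and the tree already has that object
(`EtaSignedSelmerDualData V κ K₀ ℚ_[p] η γ 1`, cc-typer-6) and the printed THEOREMS about it as named
facts (Thm. 2.2 at `η`, Thm. 4.1 first/third display at `η`, Thm. 7.4 at `η`: files
`Kobayashi2003/SignedSelmerEtaComponentFacts.lean`, `…/PlusEtaCharIdealDivisibility.lean`). What was
missing is the CONJECTURE half in the same currency as a citable node: §1 (C1⁺_η) and §2 (E⁺_η) below.
With them: 19242 ⟺ (E⁺_η) and 19114 ⟸ (C1⁺_η) modulo the descent frame + Thm. 1.2 + Thm. 2.2 at `η`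
(kernel: `Theorems/QuadraticBranchSignedControlPlusLowerInclusionOfEta.lean` p421483,
`…PlusMainConjectureBranchSeams.lean` §2 p419065, k8q-c3's `etaTransportPlus_of_decomposition`
p418003, and the converse seam `Theorems/QuadraticBranchSignedControlPlusEtaSeam.lean` of this seat),
so the planner CAN re-type the crux verbatim in print currency (the `PublishedInputKO13` move of K8
rev 7), leaving the descent frame as the only non-print content of the block.

## Source, verbatim (S. Kobayashi, *Iwasawa theory for elliptic curves at supersingular primes*,
## Invent. Math. 152 (2003) 1–36 [Kobayashi2003]; held copy `paper:doi-10-1007-s00222-002-0265-4`,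
## page = file number; p0005, p0007, p0008 re-read by seat k8q-c2 g0 2026-08-26, FIND-19114-k8q-c2.md)

p. 4: "Let `p` be an odd prime number. … Let `E` be an elliptic curve over `ℚ` with good reduction at
`p`. We assume that `a_p = 0`." p. 5: "`G_∞ = Δ × Γ` … We fix a topological generator `γ ∈ Γ`. Then
we identify `ℤ_p[[Γ]]` with `ℤ_p[[X]]` … by identifying `γ` with `1 + X`." p. 8 (§4): "Let
`η : Δ → ℤ_p^×` be a character. For a `ℤ_p[Δ]`-module `M`, let `M^η` denote the `η`-component of
`M`. … By Theorem 2.2, `X^±(E/K_∞)^η` is a torsion `ℤ_p[[Γ]]`-module. **Conjecture (Even main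
conjecture).** For every `η`, we have `Char(X⁺(E/K_∞)^η) = (L_p⁺(E, η, X))`. … **Theorem 4.1.** There
exists an integer `n ≥ 0` such that `Char(X⁺(E/K_∞)^η) ⊇ (pⁿ L_p⁺(E, η, X))` […]. If the `p`-adic
representation `Gal(ℚ̄/ℚ) → GL_{ℤ_p}(T)` is surjective, then we can take `n = 0`." p. 7, (3.4)/(3.6):
the interpolation property of `L_p⁺(E, η, X)` and `L_p⁺(E, η, 0) = −(p/τ(η))·L(E, η̄, 1)/Ω_E^δ`
(`η ≠ 1`).

## Transcription (identical frames to the named facts; flags for the referee)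

* OBJECT `X⁺(V/K_∞)^η` = ANY `D : EtaSignedSelmerDualData V κ K₀ ℚ_[p] η γ 1` (the Summits original of
  cc-typer-6; the Literature promotion copy `Kobayashi2003.EtaSignedSelmerDualData` used by the named
  facts is the same structure field for field — consumers re-package, see §3): `K₀ ⊇ ℚ(μ_p)` an
  abstract cyclotomic model (`IsCyclotomicExtension {p} ℚ K₀`, `Gal(ℚ̄/K₀)` normal), `κ` THE cyclotomic
  `ℤ_p`-extension of `ℚ`, `K₀·ℚ_∞ = K_∞ = ℚ(μ_{p^∞})`, sign `ε = 1` (plus/even), `γ ∈ Gal(ℚ̄/K₀)` with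
  `κ γ` a topological generator matching the variable (`IsCyclotomicVariable p γ`: "`γ ↦ 1 + X`").
  No flag (Kobayashi's own object; for `η² = 1` the `η`-eigen-subgroup dual IS `ε_η X`, `p ∤ #Δ`).
* WHICH `η`: `η : Γ_ℚ →* ℤˣ` trivial on `galRange K₀` and `η ≠ 1` — THE quadratic character
  `ω^{(p−1)/2}` of the cyclic group `Δ` (the conjecture is printed "for every `η`"; TODO(general form):
  `η` of any order dividing `p − 1`, which needs `ℤ_p[η]`-coefficients the tree does not carry — as in
  the named facts).
* `L_p⁺(V, η, X)` = ANY `Lη ∈ Λ` with the interpolation property (3.4) + (3.6) attached to the newform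
  `f` of `V` and the period ratio `ϖ` of the parity of `η` (`IsQuadraticBranchPlusLFunction f p ϖ Lη`,
  `QuadraticBranchSignedMainConjecture.lean`; exists by `exists_isQuadraticBranchPlusLFunction_of_isNewformOf`,
  unique up to `ℤ_p^×` by `QuadraticBranchPlusLFunctionUnique`) — flag `Kob03-Lpm-eta-upto-unit`
  (Néron `Ω_E^δ` vs the tree's period, a sign, a power of `2`): the statements are about IDEALS of
  `Λ`, which do not see the unit.
* Finite generation / torsion of `D.X` are PART of (C1⁺_η)'s conclusion (they are Thm. 2.2 at `η`, a
  named fact — so that conjunct is dischargeable today, §3) and NOT hypotheses of (E⁺_η) (an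
  inclusion of ideals needs none).

## Contents
* §1 (C1⁺_η) `QuadraticBranchPlusEtaMainConjectureAt V p` — the even main conjecture at `η`, verbatim.
* §2 (E⁺_η) `QuadraticBranchPlusEtaLowerInclusionAt V p` — its Eisenstein (lower) inclusion `⊆`.
* §3 bookkeeping, PROVED: (C1⁺_η) ⟹ (E⁺_η); Thm. 2.2 at `η` + Thm. 4.1 at `η` (named facts) +
  `ρ_{V,p^∞}` onto + (E⁺_η) ⟹ (C1⁺_η); hence on the tower-onto locus (C1⁺_η) ⟺ (E⁺_η) granted the two
  facts; the off-locus form with the integral upper inclusion displayed; and (C1⁺_η) ⟹ the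
  `η`-component frame of the route's `EtaTransportSigned` plus conjunct with its (C1_η) antecedent
  dropped (stated on the same binders, so that seat k8q-c3's consumers apply verbatim).

What is NOT here: the descent frame (piece (i)), any relation with the `F`-form nodes (that is the
Theorems-side seam files, which need the frame), any claim that either node holds for any curve.

References: [Kobayashi2003] §4 Even main conjecture + Thm. 4.1 (p. 8), Thm. 2.2 (p. 5), §3 (p. 5),
Thm. 3.2 and (3.4)/(3.6) (p. 7), proof of Thm. 7.4 (p. 13); [Kato2004Asterisque] Conj. 12.10 (p. 224)
and Thm. 12.5 (the `η`-component of Kato's main conjecture for `V` over `ℚ(μ_{p^∞})` = Kato's main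
conjecture for the additive twist `W = V ⊗ χ_{p*}` over `ℚ_∞`; shape only); [PollackRubin2004] Theorem
and remark p. 448 (CM case: remark, not theorem); [GreenbergLNM1716] §1 (p. 60).
-/

noncomputable section

open scoped Classical

open CongruenceSubgroup WeierstrassCurve Field Literature.NumberTheory.EllipticCurves
  Literature.NumberTheory.EllipticCurves.ModularForms Literature.NumberTheory.GaloisRepresentations
  ZpExtension

namespace Summit.BirchSwinnertonDyer.Rank1Residual.Additive

/-! ## §1 (C1⁺_η) — Kobayashi's even main conjecture at `η`, verbatim on `X⁺(V/K_∞)^η` -/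

/-- **TYPED STATEMENT (C1⁺_η) — Kobayashi 2003, §4 EVEN MAIN CONJECTURE at THE quadratic character
`η = ω^{(p−1)/2}`, VERBATIM on the `η`-component object** (p. 8: "By Theorem 2.2, `X^±(E/K_∞)^η` is a
torsion `ℤ_p[[Γ]]`-module. **Conjecture (Even main conjecture).** For every `η`, we have
`Char(X⁺(E/K_∞)^η) = (L_p⁺(E, η, X))`"). Frame = that of the named facts
`Kobayashi2003.thm22_etaSignedSelmerDual_finite_torsion` / `thm41_plusEtaCharIdeal_dvd` word for word:
`K₀` an abstract model of `ℚ(μ_p)`, `ηq` THE quadratic character of `Gal(K₀/ℚ)` (trivial on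
`Gal(ℚ̄/K₀)`, non-trivial), `p` odd, `V/ℚ` globally minimal, good at `p`, `a_p(V) = 0`, `f` its
newform, `ϖ` the period ratio of the parity of `η`, `Lη` ANY function with the interpolation property
of `L_p⁺(V, η, X)` (flag `Kob03-Lpm-eta-upto-unit`: ideal-level, unit-insensitive), `κ` the cyclotomic
`ℤ_p`-extension of `ℚ`, `γ ∈ Gal(ℚ̄/K₀)` a topological generator matching the variable, `D` ANY
Pontryagin-dual datum of `Sel⁺(V/K_∞)^η`. Conclusion: `D.X` finitely generated `Λ`-torsion (= Thm. 2.2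
at `η`, kept inside the node as in the `F`-form (C1_η)) and `Char(D.X) = (Lη)`. This is EXACTLY the
`η`-component form the route's crux `EtaTransportSigned` (plus conjunct) concludes under the antecedent
(C1_η), with that antecedent dropped. STATUS: CONJECTURE IN PRINT; a theorem for no curve (its `⊇` is
Thm. 4.1 up to `pⁿ`; its `⊆` is §2, OPEN). NOTHING asserted.
[cite: Kobayashi2003, §4 Even main conjecture (p. 8), Thm. 2.2 (p. 5), §3 (p. 5), (3.4) and (3.6) (p. 7); corpus `paper:doi-10-1007-s00222-002-0265-4` p0008]
[cite: PollackRubin2004, Theorem and remark p. 448 (CM case; remark only)] -/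
@[conjecture] def QuadraticBranchPlusEtaMainConjectureAt (V : WeierstrassCurve ℚ) [V.IsElliptic]
    [V.IsGloballyMinimal] (p : ℕ) [Fact p.Prime] : Prop :=
  ∀ (K₀ : Type) [Field K₀] [NumberField K₀] [IsCyclotomicExtension {p} ℚ K₀]
    [(galRange (K := ℚ) K₀).Normal] (ηq : absoluteGaloisGroup ℚ →* ℤˣ),
    (∀ σ ∈ galRange (K := ℚ) K₀, ηq σ = 1) → ηq ≠ 1 →
  ∀ {N : ℕ} [NeZero N] {f : CuspForm (Gamma0 N) 2},
    p ≠ 2 → V.HasGoodReductionAtPrime p → V.frobeniusTrace p = 0 → IsNewformOf V f →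
  ∀ (ϖ : ℚ), (if Even (p / 2) then (ϖ : ℝ) * V.realPeriodRat = plusPeriod f
      else (ϖ : ℝ) * V.imaginaryPeriodRat = minusPeriod f) →
  ∀ (Lη : IwasawaAlgebra p), IsQuadraticBranchPlusLFunction f p ϖ Lη →
  ∀ (κ : ZpExtension ℚ p) (γ : absoluteGaloisGroup ℚ),
    κ.IsCyclotomic → κ.IsTopGenerator γ → γ ∈ galRange (K := ℚ) K₀ → IsCyclotomicVariable p γ →
  ∀ (D : EtaSignedSelmerDualData V κ K₀ ℚ_[p] ηq γ 1),
    Module.Finite (IwasawaAlgebra p) D.X ∧ Module.IsTorsion (IwasawaAlgebra p) D.X ∧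
      D.charIdeal = Ideal.span {Lη}

/-! ## §2 (E⁺_η) — the Eisenstein inclusion at `η`, verbatim on `X⁺(V/K_∞)^η` -/

/-- **TYPED STATEMENT (E⁺_η) — the LOWER ("Eisenstein") inclusion of Kobayashi's even main
conjecture at `η = ω^{(p−1)/2}`, VERBATIM on the `η`-component object: `Char(X⁺(V/K_∞)^η) ⊆
(L_p⁺(V, η, X))`** — the half of "`Char(X⁺(E/K_∞)^η) = (L_p⁺(E, η, X))`" (§4 p. 8) that Kato's Euler
system does NOT give (its `⊇` up to `pⁿ` is Thm. 4.1, named fact `thm41_plusEtaCharIdeal_dvd`); by the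
proof of Thm. 7.4 (p. 13) it is the `η`-component of the inclusion `char H² ⊆ char(H¹/Z)` of Kato's
main conjecture (Astérisque 295 Conj. 12.10), equivalently Kato's lower inclusion for the ADDITIVE
twist `W = V ⊗ χ_{p*}` at `p`. Frame = §1's (the named facts'), conclusion `D.charIdeal ≤ (Lη)` for
EVERY dual datum `D` (no finiteness hypothesis: an inclusion of ideals needs none). This is EXACTLY the
displayed hypothesis `hEη` of `Theorems.plusLowerInclusionSurjBranch_of_etaLowerInclusion_of_decomposition`
(p421483), now a citable node: the print-currency form of crux 19242 `PlusLowerInclusionSurjBranch`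
(equivalent to it on every pair modulo the descent frame + Thm. 1.2 + Thm. 2.2 at `η` — Theorems-side
seam files). STATUS: OPEN for non-CM `V` (the proved ±/Kato main conjectures — Wan, Sprung,
Castella–Çiperiani–Skinner–Sprung, Burungale–Skinner–Tian–Wan arXiv:2409.01350 — are on the trivial
component of `Δ`; Fouquet–Wan arXiv:2107.13726 Thm. 5.1 CLAIMS Kato's IMC at level `Np^r` on a
sub-locus, unrefereed); for CM `V` a printed REMARK (Pollack–Rubin 2004 p. 448). NOTHING asserted.
[cite: Kobayashi2003, §4 Even main conjecture and Thm. 4.1 (p. 8), proof of Thm. 7.4 (p. 13); shape only]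
[cite: Kato2004Asterisque, Conj. 12.10 (p. 224; shape only)]
[cite: PollackRubin2004, Theorem and remark p. 448 (CM case; remark only)] -/
@[conjecture] def QuadraticBranchPlusEtaLowerInclusionAt (V : WeierstrassCurve ℚ) [V.IsElliptic]
    [V.IsGloballyMinimal] (p : ℕ) [Fact p.Prime] : Prop :=
  ∀ (K₀ : Type) [Field K₀] [NumberField K₀] [IsCyclotomicExtension {p} ℚ K₀]
    [(galRange (K := ℚ) K₀).Normal] (ηq : absoluteGaloisGroup ℚ →* ℤˣ),
    (∀ σ ∈ galRange (K := ℚ) K₀, ηq σ = 1) → ηq ≠ 1 →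
  ∀ {N : ℕ} [NeZero N] {f : CuspForm (Gamma0 N) 2},
    p ≠ 2 → V.HasGoodReductionAtPrime p → V.frobeniusTrace p = 0 → IsNewformOf V f →
  ∀ (ϖ : ℚ), (if Even (p / 2) then (ϖ : ℝ) * V.realPeriodRat = plusPeriod f
      else (ϖ : ℝ) * V.imaginaryPeriodRat = minusPeriod f) →
  ∀ (Lη : IwasawaAlgebra p), IsQuadraticBranchPlusLFunction f p ϖ Lη →
  ∀ (κ : ZpExtension ℚ p) (γ : absoluteGaloisGroup ℚ),
    κ.IsCyclotomic → κ.IsTopGenerator γ → γ ∈ galRange (K := ℚ) K₀ → IsCyclotomicVariable p γ →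
  ∀ (D : EtaSignedSelmerDualData V κ K₀ ℚ_[p] ηq γ 1), D.charIdeal ≤ Ideal.span {Lη}

/-! ## §3 Bookkeeping against the named facts Thm. 2.2 / Thm. 4.1 at `η` -/

section Bookkeeping

variable {V : WeierstrassCurve ℚ} [V.IsElliptic] [V.IsGloballyMinimal] {p : ℕ} [Fact p.Prime]

/-- **(C1⁺_η) ⟹ (E⁺_η)**: the equality of ideals gives the lower inclusion (same binders; CONDITIONAL
on the typed conjecture, nothing booked). [cite: Kobayashi2003, §4 Even main conjecture (p. 8); shape only] -/
theorem quadraticBranchPlusEtaLowerInclusionAt_of_plusEtaMainConjectureAt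
    (h : QuadraticBranchPlusEtaMainConjectureAt V p) : QuadraticBranchPlusEtaLowerInclusionAt V p := by
  intro K₀ _ _ _ _ ηq hηK hη1 N _ f hp2 hgood hap hf ϖ hϖ Lη hL κ γ hκ hγ hγK hγc D
  exact (h K₀ ηq hηK hη1 hp2 hgood hap hf ϖ hϖ Lη hL κ γ hκ hγ hγK hγc D).2.2.le

end Bookkeeping

/-! ### The Literature promotion copy of an `η`-datum (bridge, `rfl`) -/

section Bridge

universe u

variable {K : Type u} [Field K] [NumberField K] {p : ℕ} [Fact p.Prime]
  {W : WeierstrassCurve K} {κ : ZpExtension K p} {K₀ : Type u} [Field K₀] [NumberField K₀]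
  [Algebra K K₀] [(galRange (K := K) K₀).Normal] {E : Type u} [Field E] [Algebra K E]
  {η : absoluteGaloisGroup K →* ℤˣ} {γ : absoluteGaloisGroup K} {ε : ℤˣ}

/-- **The Literature promotion copy of an `η`-datum** (`Kobayashi2003.EtaSignedSelmerDualData`, the
frame of the named facts, promoted from cc-typer-6's Summits original by cell `bsd-cm`) re-packaged
from the Summits original FIELD BY FIELD on the SAME module — so that Thm. 2.2 / 4.1 / 7.4 at `η`
(named facts) apply to a Summits datum. Upstream (`Additive`-level) copy of the bridge
`Theorems.PrintReadingsOfLiterature.toLiterature` of route `InertBadSignedBranches` (which a node file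
cannot import). Pure bookkeeping. [cite: Kobayashi2003, Def. 2.1 (p. 5), §4 p. 8 (the object only)] -/
def EtaSignedSelmerDualData.toLiterature (D : EtaSignedSelmerDualData W κ K₀ E η γ ε) :
    Literature.NumberTheory.EllipticCurves.Kobayashi2003.EtaSignedSelmerDualData W κ K₀ E η γ ε :=
  ⟨D.X, D.conj_mem, D.toDual, D.bijective, D.toDual_T_smul, D.toDual_C_smul⟩

/-- The re-packaged datum has the same module (`rfl`). [cite: Kobayashi2003, §4 p. 8 (the object only)] -/
theorem EtaSignedSelmerDualData.X_toLiterature (D : EtaSignedSelmerDualData W κ K₀ E η γ ε) :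
    D.toLiterature.X = D.X :=
  rfl

/-- The re-packaged datum has the same characteristic ideal (`rfl`).
[cite: Kobayashi2003, §4 p. 8 (the object only)] -/
theorem EtaSignedSelmerDualData.charIdeal_toLiterature (D : EtaSignedSelmerDualData W κ K₀ E η γ ε) :
    D.toLiterature.charIdeal = D.charIdeal :=
  rfl

end Bridge

section Facts

variable {V : WeierstrassCurve ℚ} [V.IsElliptic] [V.IsGloballyMinimal] {p : ℕ} [Fact p.Prime]

/-- **Thm. 2.2 at `η` (NAMED fact) discharges the finiteness conjunct of (C1⁺_η)**: granted
`Kobayashi2003.thm22_etaSignedSelmerDual_finite_torsion` (hypothesis position), every `η`-datum of a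
good `a_p = 0` curve at an odd `p` is finitely generated `Λ`-torsion — through the promotion copy.
[cite: Kobayashi2003, Thm. 2.2 (p. 5) and §4 p. 8 ("By Theorem 2.2, `X^±(E/K_∞)^η` is a torsion `ℤ_p[[Γ]]`-module")] -/
theorem EtaSignedSelmerDualData.finite_isTorsion_of_thm22
    (h22 : Kobayashi2003.thm22_etaSignedSelmerDual_finite_torsion)
    {K₀ : Type} [Field K₀] [NumberField K₀] [IsCyclotomicExtension {p} ℚ K₀]
    [(galRange (K := ℚ) K₀).Normal] {ηq : absoluteGaloisGroup ℚ →* ℤˣ}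
    (hηK : ∀ σ ∈ galRange (K := ℚ) K₀, ηq σ = 1)
    (hp2 : p ≠ 2) (hgood : V.HasGoodReductionAtPrime p) (hap : V.frobeniusTrace p = 0)
    {κ : ZpExtension ℚ p} {γ : absoluteGaloisGroup ℚ} (hκ : κ.IsCyclotomic)
    (hγ : κ.IsTopGenerator γ) (hγK : γ ∈ galRange (K := ℚ) K₀) {ε : ℤˣ}
    (D : EtaSignedSelmerDualData V κ K₀ ℚ_[p] ηq γ ε) :
    Module.Finite (IwasawaAlgebra p) D.X ∧ Module.IsTorsion (IwasawaAlgebra p) D.X :=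
  h22 p K₀ ηq hηK V hp2 hgood hap κ γ hκ hγ hγK ε D.toLiterature

/-- **Thm. 4.1 first display at `η` (NAMED fact), read on a Summits datum**: granted
`Kobayashi2003.thm41_plusEtaCharIdeal_dvd` and `thm22_etaSignedSelmerDual_finite_torsion` (hypothesis
position), on §1's binders `pⁿ·Lη ∈ Char(D.X)` for some `n`, and `Lη ∈ Char(D.X)` — i.e.
`(Lη) ⊆ Char(D.X)`, the Kato-side inclusion — when `ρ_{V,p^∞}` is onto. Through the promotion copy.
[cite: Kobayashi2003, Thm. 4.1 (p. 8), first display and last sentence] -/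
theorem EtaSignedSelmerDualData.thm41_plus_of_facts
    (h22 : Kobayashi2003.thm22_etaSignedSelmerDual_finite_torsion)
    (h41 : Kobayashi2003.thm41_plusEtaCharIdeal_dvd)
    {K₀ : Type} [Field K₀] [NumberField K₀] [IsCyclotomicExtension {p} ℚ K₀]
    [(galRange (K := ℚ) K₀).Normal] {ηq : absoluteGaloisGroup ℚ →* ℤˣ}
    (hηK : ∀ σ ∈ galRange (K := ℚ) K₀, ηq σ = 1) (hη1 : ηq ≠ 1)
    {N : ℕ} [NeZero N] {f : CuspForm (Gamma0 N) 2}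
    (hp2 : p ≠ 2) (hgood : V.HasGoodReductionAtPrime p) (hap : V.frobeniusTrace p = 0)
    (hf : IsNewformOf V f) (ϖ : ℚ)
    (hϖ : if Even (p / 2) then (ϖ : ℝ) * V.realPeriodRat = plusPeriod f
      else (ϖ : ℝ) * V.imaginaryPeriodRat = minusPeriod f)
    (Lη : IwasawaAlgebra p) (hL : IsQuadraticBranchPlusLFunction f p ϖ Lη)
    {κ : ZpExtension ℚ p} {γ : absoluteGaloisGroup ℚ} (hκ : κ.IsCyclotomic)
    (hγ : κ.IsTopGenerator γ) (hγK : γ ∈ galRange (K := ℚ) K₀) (hγc : IsCyclotomicVariable p γ)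
    (D : EtaSignedSelmerDualData V κ K₀ ℚ_[p] ηq γ 1) :
    (∃ n : ℕ, (p : IwasawaAlgebra p) ^ n * Lη ∈ D.charIdeal) ∧
      ((∀ m : ℕ, V.HasSurjectiveModNGaloisRep (p ^ m : ℕ)) → Ideal.span {Lη} ≤ D.charIdeal) := by
  obtain ⟨hfin, htor⟩ :=
    EtaSignedSelmerDualData.finite_isTorsion_of_thm22 h22 hηK hp2 hgood hap hκ hγ hγK D
  obtain ⟨hn, hint⟩ := h41 p K₀ ηq hηK hη1 V hp2 hgood hap hf ϖ hϖ Lη hL κ γ hκ hγ hγK hγc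
    D.toLiterature hfin htor
  exact ⟨hn, fun hsurj => (Ideal.span_singleton_le_iff_mem _).mpr (hint hsurj)⟩

/-- **Thm. 2.2 at `η` ∧ Thm. 4.1 at `η` (NAMED facts) ∧ `ρ_{V,p^∞}` onto ∧ (E⁺_η) ⟹ (C1⁺_η).**
Granted the two printed theorems (hypothesis position) and surjectivity of the `p`-adic tower of `V`
(`∀ m, V.HasSurjectiveModNGaloisRep (p^m)`, equivalently `ρ̄_{V,p}` onto at `p ≥ 5` by Serre), the
OPEN Eisenstein inclusion (E⁺_η) is ALL that separates the tree from Kobayashi's even main conjecture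
at `η`: finite generation / torsion are Thm. 2.2, `⊇` is Thm. 4.1 with `n = 0`, `⊆` is (E⁺_η).
CONDITIONAL on the typed node; closes nothing.
[cite: Kobayashi2003, Thm. 2.2 (p. 5), Thm. 4.1 and §4 Even main conjecture (p. 8)] -/
theorem quadraticBranchPlusEtaMainConjectureAt_of_facts_of_surjective_of_etaLowerInclusion
    (h22 : Kobayashi2003.thm22_etaSignedSelmerDual_finite_torsion)
    (h41 : Kobayashi2003.thm41_plusEtaCharIdeal_dvd)
    (hsurj : ∀ m : ℕ, V.HasSurjectiveModNGaloisRep (p ^ m : ℕ))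
    (hE : QuadraticBranchPlusEtaLowerInclusionAt V p) :
    QuadraticBranchPlusEtaMainConjectureAt V p := by
  intro K₀ _ _ _ _ ηq hηK hη1 N _ f hp2 hgood hap hf ϖ hϖ Lη hL κ γ hκ hγ hγK hγc D
  obtain ⟨hfin, htor⟩ :=
    EtaSignedSelmerDualData.finite_isTorsion_of_thm22 h22 hηK hp2 hgood hap hκ hγ hγK D
  obtain ⟨-, hup⟩ := EtaSignedSelmerDualData.thm41_plus_of_facts h22 h41 hηK hη1 hp2 hgood hap hf
    ϖ hϖ Lη hL hκ hγ hγK hγc D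
  exact ⟨hfin, htor,
    le_antisymm (hE K₀ ηq hηK hη1 hp2 hgood hap hf ϖ hϖ Lη hL κ γ hκ hγ hγK hγc D) (hup hsurj)⟩

/-- **On the tower-onto locus, (C1⁺_η) ⟺ (E⁺_η) granted Thm. 2.2 / Thm. 4.1 at `η` (named facts).**
Kobayashi's even main conjecture at `η` IS its Eisenstein half there — the print-currency twin of
`quadraticBranchPlusMainConjectureAt_iff_lowerInclusion_of_katoDivisibility` (the `F`-form, p418001),
with the READING (RK⁺) replaced by the two NAMED facts. CONDITIONAL; nothing booked.
[cite: Kobayashi2003, Thm. 2.2 (p. 5), Thm. 4.1 and §4 Even main conjecture (p. 8)] -/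
theorem quadraticBranchPlusEtaMainConjectureAt_iff_etaLowerInclusion_of_facts_of_surjective
    (h22 : Kobayashi2003.thm22_etaSignedSelmerDual_finite_torsion)
    (h41 : Kobayashi2003.thm41_plusEtaCharIdeal_dvd)
    (hsurj : ∀ m : ℕ, V.HasSurjectiveModNGaloisRep (p ^ m : ℕ)) :
    QuadraticBranchPlusEtaMainConjectureAt V p ↔ QuadraticBranchPlusEtaLowerInclusionAt V p :=
  ⟨quadraticBranchPlusEtaLowerInclusionAt_of_plusEtaMainConjectureAt,
    quadraticBranchPlusEtaMainConjectureAt_of_facts_of_surjective_of_etaLowerInclusion h22 h41 hsurj⟩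

/-- **Off the tower-onto locus** (the CM twists and the non-CM small-image twists, where Thm. 4.1
only gives `pⁿ`): granted Thm. 2.2 at `η` (named fact) for finiteness, (C1⁺_η) follows from (E⁺_η)
together with the INTEGRAL Kato-side inclusion `(Lη) ⊆ Char(D.X)` DISPLAYED as a hypothesis `hup` on
the same binders (itself a consequence of (C1⁺_η); with (E⁺_η) and Thm. 4.1's `pⁿ` it says the two
characteristic power series have the same `μ`-invariant). CONDITIONAL; nothing booked.
[cite: Kobayashi2003, Thm. 2.2 (p. 5), Thm. 4.1 and §4 Even main conjecture (p. 8)] -/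
theorem quadraticBranchPlusEtaMainConjectureAt_of_thm22_of_upper_of_etaLowerInclusion
    (h22 : Kobayashi2003.thm22_etaSignedSelmerDual_finite_torsion)
    (hup : ∀ (K₀ : Type) [Field K₀] [NumberField K₀] [IsCyclotomicExtension {p} ℚ K₀]
        [(galRange (K := ℚ) K₀).Normal] (ηq : absoluteGaloisGroup ℚ →* ℤˣ),
        (∀ σ ∈ galRange (K := ℚ) K₀, ηq σ = 1) → ηq ≠ 1 →
      ∀ {N : ℕ} [NeZero N] {f : CuspForm (Gamma0 N) 2},
        p ≠ 2 → V.HasGoodReductionAtPrime p → V.frobeniusTrace p = 0 → IsNewformOf V f →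
      ∀ (ϖ : ℚ), (if Even (p / 2) then (ϖ : ℝ) * V.realPeriodRat = plusPeriod f
          else (ϖ : ℝ) * V.imaginaryPeriodRat = minusPeriod f) →
      ∀ (Lη : IwasawaAlgebra p), IsQuadraticBranchPlusLFunction f p ϖ Lη →
      ∀ (κ : ZpExtension ℚ p) (γ : absoluteGaloisGroup ℚ),
        κ.IsCyclotomic → κ.IsTopGenerator γ → γ ∈ galRange (K := ℚ) K₀ → IsCyclotomicVariable p γ →
      ∀ (D : EtaSignedSelmerDualData V κ K₀ ℚ_[p] ηq γ 1), Ideal.span {Lη} ≤ D.charIdeal)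
    (hE : QuadraticBranchPlusEtaLowerInclusionAt V p) :
    QuadraticBranchPlusEtaMainConjectureAt V p := by
  intro K₀ _ _ _ _ ηq hηK hη1 N _ f hp2 hgood hap hf ϖ hϖ Lη hL κ γ hκ hγ hγK hγc D
  obtain ⟨hfin, htor⟩ :=
    EtaSignedSelmerDualData.finite_isTorsion_of_thm22 h22 hηK hp2 hgood hap hκ hγ hγK D
  exact ⟨hfin, htor,
    le_antisymm (hE K₀ ηq hηK hη1 hp2 hgood hap hf ϖ hϖ Lη hL κ γ hκ hγ hγK hγc D)
      (hup K₀ ηq hηK hη1 hp2 hgood hap hf ϖ hϖ Lη hL κ γ hκ hγ hγK hγc D)⟩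

/-- **The rational form of (E⁺_η) as a divisibility of power series** (the shape the census and the
rank-`0` lower half read): granted (E⁺_η), for a characteristic power series `g` of `X⁺(V/K_∞)^η`
(`Char(D.X) = (g)`) one has **`Lη ∣ g`** (`Ideal.span_singleton_le_span_singleton`); with Thm. 4.1's
`g ∣ pⁿ·Lη` (resp. `g ∣ Lη` on the tower-onto locus) the two generate the same ideal up to `pⁿ`.
[cite: Kobayashi2003, §4 Even main conjecture and Thm. 4.1 (p. 8)] -/
theorem QuadraticBranchPlusEtaLowerInclusionAt.dvd_of_charIdeal_eq
    (hE : QuadraticBranchPlusEtaLowerInclusionAt V p)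
    {K₀ : Type} [Field K₀] [NumberField K₀] [IsCyclotomicExtension {p} ℚ K₀]
    [(galRange (K := ℚ) K₀).Normal] {ηq : absoluteGaloisGroup ℚ →* ℤˣ}
    (hηK : ∀ σ ∈ galRange (K := ℚ) K₀, ηq σ = 1) (hη1 : ηq ≠ 1)
    {N : ℕ} [NeZero N] {f : CuspForm (Gamma0 N) 2}
    (hp2 : p ≠ 2) (hgood : V.HasGoodReductionAtPrime p) (hap : V.frobeniusTrace p = 0)
    (hf : IsNewformOf V f) (ϖ : ℚ)
    (hϖ : if Even (p / 2) then (ϖ : ℝ) * V.realPeriodRat = plusPeriod f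
      else (ϖ : ℝ) * V.imaginaryPeriodRat = minusPeriod f)
    (Lη : IwasawaAlgebra p) (hL : IsQuadraticBranchPlusLFunction f p ϖ Lη)
    {κ : ZpExtension ℚ p} {γ : absoluteGaloisGroup ℚ} (hκ : κ.IsCyclotomic)
    (hγ : κ.IsTopGenerator γ) (hγK : γ ∈ galRange (K := ℚ) K₀) (hγc : IsCyclotomicVariable p γ)
    (D : EtaSignedSelmerDualData V κ K₀ ℚ_[p] ηq γ 1) {g : IwasawaAlgebra p}
    (hg : D.charIdeal = Ideal.span {g}) : Lη ∣ g := by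
  have h := hE K₀ ηq hηK hη1 hp2 hgood hap hf ϖ hϖ Lη hL κ γ hκ hγ hγK hγc D
  rw [hg, Ideal.span_singleton_le_span_singleton] at h
  exact h

end Facts

end Summit.BirchSwinnertonDyer.Rank1Residual.Additive

end
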